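import Summits.QuantumFields.BalabanUV.T4Continuum.Support.SmoothRefineInterp
import HarnessLib

/-!
# T⁴ programme, node NE3 — the kinematic refinement lemma, abelian line, file 4: THE CUBICAL WHITNEY REFINEMENT OF A
# CLOSED COARSE 2-COCHAIN AND ITS EXPLICIT HOMOTOPY TO THE CORNER PULLBACK (`SmoothRefineWhitney`)

Cell `pub-balaban`, NE3 formalisation swarm (`t4/formal/NE3/LEAVES.md` row S4b, unit
`b2b-balaban-t4-ne3-formalise-leaf-10`); sequel of `SmoothRefineInterp`.  PURE LATTICE CALCULUS, values in a real vector
space `X`.  A coarse 2-cochain is `F : Site d → Fin d → Fin d → X` (antisymmetric in the two directions); it is CLOSED when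
the lattice Bianchi identity `∇_αF_{βγ} + ∇_βF_{γα} + ∇_γF_{αβ} = 0` holds.  Two refinements of `F` to the `L`-times finer
lattice (fine plaquette `(y; μ, ν)`, block `z = ⌊y/L⌋`, offset `ρ`):
* the CORNER PULLBACK `cornerPull L F (y;μν) = [ρ_μ = ρ_ν = L−1]·F(z;μν)` — all of the coarse plaquette's value on the
  one fine plaquette in its far corner (this is the fine flux of the slice pullback of a coarse configuration,
  `SmoothRefineSlices.hol_slicePull_plaqWord`);
* the WHITNEY REFINEMENT `whitney L F (y;μν) = L^{−2}·Interp_{λ≠μ,ν} F_{μν}` — the value spread evenly over the `L²`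
  fine plaquettes of the coarse 2-cell and interpolated multilinearly in the transverse directions (the cubical Whitney
  2-form; smooth and small).
THE THEOREM OF THIS FILE (`dC_whitneyPot`): for CLOSED antisymmetric `F` the explicit, local fine 1-cochain
`whitneyPot L F = Σ_k c^{(k)}`, `c^{(k)}(y,ν) = (ρ_k/L)·a_k(ν)·Interp_{ {κ<k}∖{ν} } F_{kν}` (`a_k(ν) = 1/L` if `ν < k`, else
`[ρ_ν = L−1]`), satisfies `d(whitneyPot L F) = whitney L F − cornerPull L F`.  Mechanism: refine ONE coordinate direction at a
time; `F^{(k)}` (interpolated in the directions `< k`, corner-concentrated in the others) moves to `F^{(k+1)}` by the exact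
cochain `d c^{(k)}` (`dC_cStep`, three cases `k ∉ {μ,ν}` ∕ `k = μ` ∕ `k = ν`, closedness used once); telescoping in `k`.
(The one-dimensional homotopy between linear interpolation and left-endpoint extension, tensorised; standard in the
finite-element ∕ mimetic-discretisation literature for cubical Whitney forms — here written out on `ℤ^d`, no source is a
hypothesis.)

HONEST FRAMING: finite-`T⁴` lattice calculus for the kinematics of block averaging (rung (B)+1 — NOT infinite volume, NOT
a mass gap, NOT Clay); no estimate of the programme, nothing of NE3 claimed; no `BetaPertH`, no (B), no G-an2-4.
PLACEMENT (human rule 2026-08-19): our work, under `Summits/QuantumFields/BalabanUV/`.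
-/

set_option autoImplicit false

open scoped BigOperators

namespace Summit.QuantumFields.BalabanUV.T4Continuum.SmoothRefineWhitney

open Literature.MathematicalPhysics.QuantumFieldTheory.Balaban1983to89
open B7Prop1Explicit SmoothRefineBlocks SmoothRefineInterp

noncomputable section

variable {d : ℕ}


/-! ## §1 Cochains, the coboundary, the initial segments of directions -/

section Additive

variable {X : Type*} [AddCommGroup X]

/-- The coboundary of a 1-cochain at the plaquette `(y; μ, ν)`: `a(y,μ) + a(y+e_μ,ν) − a(y+e_ν,μ) − a(y,ν)` (the order of
`B7Prop1Explicit.asum_plaqWord`). [folklore] -/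
def dC (a : Site d → Fin d → X) (y : Site d) (μ ν : Fin d) : X := a y μ + a (y + e μ) ν - a (y + e ν) μ - a y ν

/-- `dC` is additive over finite sums of cochains. [folklore] -/
theorem dC_sum {ι : Type*} (s : Finset ι) (a : ι → Site d → Fin d → X) (y : Site d) (μ ν : Fin d) :
    dC (fun y ν => ∑ k ∈ s, a k y ν) y μ ν = ∑ k ∈ s, dC (a k) y μ ν := by
  simp only [dC, Finset.sum_add_distrib, Finset.sum_sub_distrib]

/-- On the diagonal everything vanishes: `dC a y μ μ = 0`. [folklore] -/
theorem dC_self (a : Site d → Fin d → X) (y : Site d) (μ : Fin d) : dC a y μ μ = 0 := by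
  simp only [dC]; abel

/-- The directions below `k`. [folklore] -/
def lower (k : ℕ) : Finset (Fin d) := Finset.univ.filter fun κ : Fin d => κ.val < k

/-- Membership in `lower k`. [folklore] -/
@[simp] theorem mem_lower {k : ℕ} {κ : Fin d} : κ ∈ lower k ↔ κ.val < k := by simp [lower]

/-- `lower 0 = ∅`. [folklore] -/
theorem lower_zero : lower (d := d) 0 = ∅ := by ext κ; simp

/-- `lower d` is everything. [folklore] -/
theorem lower_top : lower (d := d) d = Finset.univ := by ext κ; simp [κ.isLt]

/-- `lower (k+1) = insert k (lower k)`. [folklore] -/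
theorem lower_succ (k : Fin d) : lower (d := d) (k.val + 1) = insert k (lower k.val) := by
  ext κ
  simp only [mem_lower, Finset.mem_insert, Fin.ext_iff]
  omega

/-- `k ∉ lower k`. [folklore] -/
theorem notMem_lower_self (k : Fin d) : k ∉ lower (d := d) k.val := by simp

/-- ANTISYMMETRY of a coarse 2-cochain: `F(z; ν, μ) = −F(z; μ, ν)` (a hypothesis, asserted for nothing here). [folklore] -/
abbrev Anti2 (F : Site d → Fin d → Fin d → X) : Prop := ∀ (z : Site d) (μ ν : Fin d), F z ν μ = -F z μ ν

/-- CLOSEDNESS (lattice Bianchi) of a coarse 2-cochain: `∇_α F_{βγ} + ∇_β F_{γα} + ∇_γ F_{αβ} = 0` (a hypothesis,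
asserted for nothing here). [folklore] -/
abbrev Closed2 (F : Site d → Fin d → Fin d → X) : Prop :=
  ∀ (z : Site d) (α β γ : Fin d),
    (F (z + e α) β γ - F z β γ) + (F (z + e β) γ α - F z γ α) + (F (z + e γ) α β - F z α β) = 0

/-- The mixed derivative exchange of a closed form: `∇_μF_{kν} − ∇_νF_{kμ} = ∇_kF_{μν}`. [folklore] -/
theorem exchange_of_closed {F : Site d → Fin d → Fin d → X} (ha : Anti2 F) (hc : Closed2 F) (z : Site d)
    (k μ ν : Fin d) : cfd μ (fun x => F x k ν) z - cfd ν (fun x => F x k μ) z = cfd k (fun x => F x μ ν) z := by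
  have h := hc z k μ ν
  rw [ha (z + e μ) k ν, ha z k ν] at h
  simp only [cfd]
  have key : (F (z + e μ) k ν - F z k ν) - (F (z + e ν) k μ - F z k μ) - (F (z + e k) μ ν - F z μ ν)
      = -((F (z + e k) μ ν - F z μ ν) + (-F (z + e μ) k ν - -F z k ν) + (F (z + e ν) k μ - F z k μ)) := by abel
  rw [h, neg_zero] at key
  exact sub_eq_zero.1 key

/-- THE CORNER PULLBACK `[ρ_μ = ρ_ν = L−1]·F(⌊y/L⌋; μ, ν)`. [folklore] -/
def cornerPull (L : ℕ) (F : Site d → Fin d → Fin d → X) (y : Site d) (μ ν : Fin d) : X :=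
  if res L y μ = (L : ℤ) - 1 ∧ res L y ν = (L : ℤ) - 1 then F (blk L y) μ ν else 0

end Additive

section Defs

variable {X : Type*} [AddCommGroup X] [Module ℝ X]

/-! ## §2 The partial refinements `F^{(k)}` and the step potentials `c^{(k)}` -/

/-- THE PARTIAL REFINEMENT `F^{(k)}`: Whitney (weight `1/L`, interpolated) in the directions `< k`, corner-concentrated
(last-slice indicator, piecewise constant) in the directions `≥ k`. [folklore] -/
def Fk (L : ℕ) (k : ℕ) (F : Site d → Fin d → Fin d → X) (y : Site d) (μ ν : Fin d) : X :=
  (dcoef L (lower k) y μ * dcoef L (lower k) y ν) • interp L (((lower k).erase μ).erase ν) (fun z => F z μ ν) y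

/-- THE STEP POTENTIAL `c^{(k)}(y, ν) = (ρ_k/L)·a_k(ν)·Interp_{ {κ<k}∖{ν} } F_{kν}` (`ν ≠ k`; `0` in direction `k`): the
one-dimensional homotopy `h(a)(Lz + ρ) = (ρ/L)·a(z)` applied in the direction `k` being refined. [folklore] -/
def cStep (L : ℕ) (k : Fin d) (F : Site d → Fin d → Fin d → X) (y : Site d) (ν : Fin d) : X :=
  if ν = k then 0 else (wt L y k * dcoef L (lower k.val) y ν) • interp L ((lower k.val).erase ν) (fun z => F z k ν) y

/-- THE WHITNEY POTENTIAL: the sum of the step potentials. [folklore] -/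
def whitneyPot (L : ℕ) (F : Site d → Fin d → Fin d → X) (y : Site d) (ν : Fin d) : X := ∑ k : Fin d, cStep L k F y ν

/-- THE WHITNEY REFINEMENT `L^{−2}·Interp_{λ ≠ μ,ν} F_{μν}`. [folklore] -/
def whitney (L : ℕ) (F : Site d → Fin d → Fin d → X) (y : Site d) (μ ν : Fin d) : X :=
  (1 / (L : ℝ) ^ 2) • interp L ((Finset.univ.erase μ).erase ν) (fun z => F z μ ν) y

/-- At `k = d` the partial refinement is the Whitney refinement. [folklore] -/
theorem Fk_top (L : ℕ) (F : Site d → Fin d → Fin d → X) (y : Site d) (μ ν : Fin d) :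
    Fk L d F y μ ν = whitney L F y μ ν := by
  simp only [Fk, whitney, lower_top, dcoef, Finset.mem_univ, ↓reduceIte]
  congr 1
  ring

/-- At `k = 0` the partial refinement is the corner pullback. [folklore] -/
theorem Fk_zero (L : ℕ) (F : Site d → Fin d → Fin d → X) (y : Site d) (μ ν : Fin d) :
    Fk L 0 F y μ ν = cornerPull L F y μ ν := by
  simp only [Fk, cornerPull, lower_zero, dcoef, Finset.notMem_empty, ↓reduceIte, Finset.erase_empty, interp_empty]
  by_cases hμ : res L y μ = (L : ℤ) - 1 <;> by_cases hν : res L y ν = (L : ℤ) - 1 <;> simp [hμ, hν]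

/-! ## §3 One refinement step: `d c^{(k)} = F^{(k+1)} − F^{(k)}` -/

/-- `dcoef` does not see the erasure of a different direction. [folklore] -/
theorem dcoef_erase_of_ne (L : ℕ) (S : Finset (Fin d)) (y : Site d) {α β : Fin d} (h : α ≠ β) :
    dcoef L (S.erase β) y α = dcoef L S y α := by
  simp [dcoef, Finset.mem_erase, h]

/-- `dcoef` in a piecewise-constant direction is unchanged by a unit step in another direction. [folklore] -/
theorem dcoef_add_e_of_ne {L : ℕ} (hL : 1 ≤ L) (S : Finset (Fin d)) (y : Site d) {α β : Fin d} (h : α ≠ β) :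
    dcoef L S (y + e β) α = dcoef L S y α := by
  simp [dcoef, res_add_e_ne hL y h]

/-- The weight in direction `k` is unchanged by a unit step in another direction. [folklore] -/
theorem wt_add_e_of_ne {L : ℕ} (hL : 1 ≤ L) (y : Site d) {k β : Fin d} (h : k ≠ β) : wt L (y + e β) k = wt L y k := by
  simp [wt, res_add_e_ne hL y h]

/-- The difference of a step potential in a direction other than `k` and the potential's own direction. [folklore] -/
theorem cStep_fd_of_ne {L : ℕ} (hL : 1 ≤ L) (k : Fin d) (F : Site d → Fin d → Fin d → X) (y : Site d) {μ ν : Fin d}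
    (hνk : ν ≠ k) (hμk : μ ≠ k) (hμν : μ ≠ ν) :
    cStep L k F (y + e μ) ν - cStep L k F y ν =
      (wt L y k * dcoef L (lower k.val) y μ * dcoef L (lower k.val) y ν) •
        interp L (((lower k.val).erase μ).erase ν) (cfd μ fun z => F z k ν) y := by
  simp only [cStep, if_neg hνk, wt_add_e_of_ne hL y (Ne.symm hμk), dcoef_add_e_of_ne hL _ y (Ne.symm hμν)]
  rw [← smul_sub, interp_fd hL, dcoef_erase_of_ne L _ y hμν, Finset.erase_right_comm, smul_smul]
  congr 1; ring

/-- The difference of a step potential in its refined direction `k`. [folklore] -/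
theorem cStep_fd_self {L : ℕ} (hL : 1 ≤ L) (k : Fin d) (F : Site d → Fin d → Fin d → X) (y : Site d) {ν : Fin d}
    (hνk : ν ≠ k) :
    cStep L k F (y + e k) ν - cStep L k F y ν =
      ((1 / (L : ℝ) - (if res L y k = (L : ℤ) - 1 then 1 else 0)) * dcoef L (lower k.val) y ν) •
        interp L ((lower k.val).erase ν) (fun z => F z k ν) y := by
  have hL0 : (L : ℝ) ≠ 0 := by exact_mod_cast (by omega : L ≠ 0)
  have hkS : k ∉ (lower (d := d) k.val).erase ν := fun h => notMem_lower_self k (Finset.mem_of_mem_erase h)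
  simp only [cStep, if_neg hνk, dcoef_add_e_of_ne hL _ y hνk, interp_add_e_of_notMem hL hkS]
  have hwt : wt L (y + e k) k = if res L y k = (L : ℤ) - 1 then 0 else wt L y k + 1 / (L : ℝ) := by
    simp only [wt, res_add_e_self hL]
    split_ifs <;> simp [add_div]
  rw [hwt]
  by_cases h : res L y k = (L : ℤ) - 1
  · simp only [h, ↓reduceIte, zero_mul, zero_smul, zero_sub]
    have hw : wt L y k = 1 - 1 / (L : ℝ) := by
      simp only [wt, h]; push_cast; field_simp
    rw [hw, ← neg_smul]
    congr 1; ring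
  · simp only [h, ↓reduceIte, sub_zero, ← sub_smul]
    congr 1; ring

/-- The step potential vanishes in its own direction. [folklore] -/
@[simp] theorem cStep_self (L : ℕ) (k : Fin d) (F : Site d → Fin d → Fin d → X) (y : Site d) : cStep L k F y k = 0 := by
  simp [cStep]

/-- `a_{k+1}(k) = 1/L`. [folklore] -/
theorem dcoef_lower_succ_self (L : ℕ) (k : Fin d) (y : Site d) : dcoef L (lower (k.val + 1)) y k = 1 / (L : ℝ) := by
  simp [dcoef]

/-- `a_k(k) = [ρ_k = L − 1]`. [folklore] -/
theorem dcoef_lower_self (L : ℕ) (k : Fin d) (y : Site d) :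
    dcoef L (lower k.val) y k = if res L y k = (L : ℤ) - 1 then 1 else 0 := by
  simp [dcoef]

/-- `a_{k+1}(μ) = a_k(μ)` for `μ ≠ k`. [folklore] -/
theorem dcoef_lower_succ_of_ne (L : ℕ) {k μ : Fin d} (h : μ ≠ k) (y : Site d) :
    dcoef L (lower (k.val + 1)) y μ = dcoef L (lower k.val) y μ := by
  have : (μ.val < k.val + 1) ↔ (μ.val < k.val) := by
    have : μ.val ≠ k.val := fun h' => h (Fin.ext h')
    omega
  simp [dcoef, this]

/-- `({κ < k+1} ∖ {k}) ∖ {ν} = {κ < k} ∖ {ν}`. [folklore] -/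
theorem lower_succ_erase_self (k ν : Fin d) : ((lower (d := d) (k.val + 1)).erase k).erase ν = (lower k.val).erase ν := by
  rw [lower_succ, Finset.erase_insert (notMem_lower_self k)]

/-- `({κ < k} ∖ {k}) = {κ < k}`. [folklore] -/
theorem lower_erase_self (k : Fin d) : (lower (d := d) k.val).erase k = lower k.val :=
  Finset.erase_eq_of_notMem (notMem_lower_self k)

/-- `({κ < k+1} ∖ {μ}) ∖ {k} = {κ < k} ∖ {μ}`. [folklore] -/
theorem lower_succ_erase_erase_self (k μ : Fin d) :
    ((lower (d := d) (k.val + 1)).erase μ).erase k = (lower k.val).erase μ := by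
  rw [Finset.erase_right_comm, lower_succ_erase_self]

/-- **ONE REFINEMENT STEP**: for closed antisymmetric `F` and `μ ≠ ν`, `d c^{(k)} (y;μν) = F^{(k+1)}(y;μν) − F^{(k)}(y;μν)`.
[folklore] -/
theorem dC_cStep {L : ℕ} (hL : 1 ≤ L) (k : Fin d) {F : Site d → Fin d → Fin d → X} (ha : Anti2 F) (hc : Closed2 F)
    (y : Site d) {μ ν : Fin d} (hμν : μ ≠ ν) :
    dC (cStep L k F) y μ ν = Fk L (k.val + 1) F y μ ν - Fk L k.val F y μ ν := by
  -- the coboundary as the difference of two differences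
  have hdC : dC (cStep L k F) y μ ν
      = (cStep L k F (y + e μ) ν - cStep L k F y ν) - (cStep L k F (y + e ν) μ - cStep L k F y μ) := by
    simp only [dC]; abel
  rw [hdC]
  by_cases hμk : μ = k
  · -- the refined direction is the FIRST direction of the plaquette
    subst hμk
    have hνk : ν ≠ μ := fun h => hμν h.symm
    rw [cStep_fd_self hL μ F y hνk, cStep_self, cStep_self, sub_zero, sub_zero]
    simp only [Fk]
    rw [dcoef_lower_succ_self, dcoef_lower_self, dcoef_lower_succ_of_ne L hνk, lower_succ_erase_self,
      lower_erase_self, ← sub_smul]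
    congr 1
    ring
  by_cases hνk : ν = k
  · -- the refined direction is the SECOND direction of the plaquette
    subst hνk
    rw [cStep_fd_self hL ν F y hμk, cStep_self, cStep_self, sub_self, zero_sub]
    simp only [Fk]
    rw [dcoef_lower_succ_self, dcoef_lower_self, dcoef_lower_succ_of_ne L hμk, lower_succ_erase_erase_self ν μ,
      Finset.erase_right_comm, lower_erase_self]
    -- `F_{μν} = −F_{νμ}` inside the interpolation
    have hI : interp L ((lower ν.val).erase μ) (fun z => F z μ ν) y
        = -interp L ((lower ν.val).erase μ) (fun z => F z ν μ) y := by
      rw [show (fun z => F z μ ν) = fun z => (-1 : ℝ) • F z ν μ from funext fun z => by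
        rw [ha z ν μ, neg_one_smul], interp_smul, neg_one_smul]
    rw [hI]
    module
  · -- the refined direction is transverse to the plaquette
    rw [cStep_fd_of_ne hL k F y hνk hμk hμν, cStep_fd_of_ne hL k F y hμk hνk (Ne.symm hμν),
      Finset.erase_right_comm (a := ν) (b := μ),
      show wt L y k * dcoef L (lower k.val) y ν * dcoef L (lower k.val) y μ
        = wt L y k * dcoef L (lower k.val) y μ * dcoef L (lower k.val) y ν by ring, ← smul_sub, ← interp_sub]
    -- closedness: `∇_μ F_{kν} − ∇_ν F_{kμ} = ∇_k F_{μν}`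
    rw [show (fun x => cfd μ (fun z => F z k ν) x - cfd ν (fun z => F z k μ) x) = cfd k (fun z => F z μ ν) from
      funext fun x => exchange_of_closed ha hc x k μ ν]
    -- the right side: one more interpolated direction
    have hkT : k ∉ ((lower (d := d) k.val).erase μ).erase ν := fun h =>
      notMem_lower_self k (Finset.mem_of_mem_erase (Finset.mem_of_mem_erase h))
    simp only [Fk]
    rw [dcoef_lower_succ_of_ne L hμk, dcoef_lower_succ_of_ne L hνk, lower_succ,
      Finset.erase_insert_of_ne (Ne.symm hμk), Finset.erase_insert_of_ne (Ne.symm hνk), interp_insert L hkT]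
    unfold cfd
    rw [interp_sub]
    module

/-- MEMBERSHIP of a step potential in a real-stable additive subgroup containing the values of `F`. [folklore] -/
theorem cStep_mem (K : AddSubgroup X) (hK : ∀ (r : ℝ) (x : X), x ∈ K → r • x ∈ K) (L : ℕ) (k : Fin d)
    {F : Site d → Fin d → Fin d → X} (hF : ∀ z μ ν, F z μ ν ∈ K) (y : Site d) (ν : Fin d) : cStep L k F y ν ∈ K := by
  unfold cStep
  split_ifs
  · exact K.zero_mem
  · exact hK _ _ (interp_mem K hK L _ (fun x => hF x k ν) y)

/-- MEMBERSHIP of the Whitney potential. [folklore] -/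
theorem whitneyPot_mem (K : AddSubgroup X) (hK : ∀ (r : ℝ) (x : X), x ∈ K → r • x ∈ K) (L : ℕ)
    {F : Site d → Fin d → Fin d → X} (hF : ∀ z μ ν, F z μ ν ∈ K) (y : Site d) (ν : Fin d) : whitneyPot L F y ν ∈ K := by
  unfold whitneyPot
  exact Finset.sum_induction _ (fun x => x ∈ K) (fun a b ha hb => K.add_mem ha hb) K.zero_mem
    (fun k _ => cStep_mem K hK L k hF y ν)

/-! ## §4 The telescoping sum: `d(whitneyPot F) = whitney F − cornerPull F` -/

/-- **THE WHITNEY HOMOTOPY**: for a closed antisymmetric coarse 2-cochain `F` and `μ ≠ ν`,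
`d(whitneyPot L F)(y; μ, ν) = whitney L F (y; μ, ν) − cornerPull L F (y; μ, ν)`. [folklore] -/
theorem dC_whitneyPot {L : ℕ} (hL : 1 ≤ L) {F : Site d → Fin d → Fin d → X} (ha : Anti2 F) (hc : Closed2 F)
    (y : Site d) {μ ν : Fin d} (hμν : μ ≠ ν) :
    dC (whitneyPot L F) y μ ν = whitney L F y μ ν - cornerPull L F y μ ν := by
  unfold whitneyPot
  rw [dC_sum, Finset.sum_congr rfl fun k _ => dC_cStep hL k ha hc y hμν, ← Fk_top, ← Fk_zero]
  have h := Finset.sum_range_sub (fun i => Fk L i F y μ ν) d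
  rw [← Fin.sum_univ_eq_sum_range (fun i => Fk L (i + 1) F y μ ν - Fk L i F y μ ν) d] at h
  exact h

end Defs

/-! ## §5 Sizes: the Whitney refinement and its potential are as small as `F` -/

section Sizes

variable {X : Type*} [NormedAddCommGroup X] [NormedSpace ℝ X]

/-- `‖whitney L F (y;μν)‖ ≤ M/L²` from `‖F‖ ≤ M`. [folklore] -/
theorem norm_whitney_le {L : ℕ} (hL : 1 ≤ L) (F : Site d → Fin d → Fin d → X) {M : ℝ}
    (hM : ∀ z μ ν, ‖F z μ ν‖ ≤ M) (y : Site d) (μ ν : Fin d) : ‖whitney L F y μ ν‖ ≤ M / (L : ℝ) ^ 2 := by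
  rw [whitney, norm_smul, Real.norm_of_nonneg (by positivity)]
  calc 1 / (L : ℝ) ^ 2 * ‖interp L ((Finset.univ.erase μ).erase ν) (fun z => F z μ ν) y‖
      ≤ 1 / (L : ℝ) ^ 2 * M :=
        mul_le_mul_of_nonneg_left (norm_interp_le hL _ _ (fun x => hM x μ ν) y) (by positivity)
    _ = M / (L : ℝ) ^ 2 := by ring

omit [NormedSpace ℝ X] in
/-- `‖cornerPull L F (y;μν)‖ ≤ ‖F (blk y) μ ν‖`. [folklore] -/
theorem norm_cornerPull_le (L : ℕ) (F : Site d → Fin d → Fin d → X) (y : Site d) (μ ν : Fin d) :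
    ‖cornerPull L F y μ ν‖ ≤ ‖F (blk L y) μ ν‖ := by
  unfold cornerPull; split_ifs <;> simp

/-- `‖c^{(k)}(y,ν)‖ ≤ M` from `‖F‖ ≤ M` (all coefficients lie in `[0,1]`). [folklore] -/
theorem norm_cStep_le {L : ℕ} (hL : 1 ≤ L) (k : Fin d) (F : Site d → Fin d → Fin d → X) {M : ℝ}
    (hM : ∀ z μ ν, ‖F z μ ν‖ ≤ M) (y : Site d) (ν : Fin d) : ‖cStep L k F y ν‖ ≤ M := by
  have hM0 : 0 ≤ M := (norm_nonneg _).trans (hM y k ν)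
  unfold cStep
  split_ifs
  · simpa using hM0
  · rw [norm_smul]
    have h1 : ‖wt L y k * dcoef L (lower k.val) y ν‖ ≤ 1 := by
      rw [norm_mul, Real.norm_of_nonneg (wt_nonneg hL y k), Real.norm_eq_abs]
      exact mul_le_one₀ (wt_le_one hL y k) (abs_nonneg _) (abs_dcoef_le_one hL _ y ν)
    calc ‖wt L y k * dcoef L (lower k.val) y ν‖ * ‖interp L ((lower k.val).erase ν) (fun z => F z k ν) y‖
        ≤ 1 * M := mul_le_mul h1 (norm_interp_le hL _ _ (fun x => hM x k ν) y) (norm_nonneg _) zero_le_one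
      _ = M := one_mul M

/-- `‖whitneyPot L F (y,ν)‖ ≤ d·M` from `‖F‖ ≤ M`. [folklore] -/
theorem norm_whitneyPot_le {L : ℕ} (hL : 1 ≤ L) (F : Site d → Fin d → Fin d → X) {M : ℝ}
    (hM : ∀ z μ ν, ‖F z μ ν‖ ≤ M) (y : Site d) (ν : Fin d) : ‖whitneyPot L F y ν‖ ≤ d * M := by
  unfold whitneyPot
  calc ‖∑ k : Fin d, cStep L k F y ν‖ ≤ ∑ k : Fin d, ‖cStep L k F y ν‖ := norm_sum_le _ _
    _ ≤ ∑ _k : Fin d, M := Finset.sum_le_sum fun k _ => norm_cStep_le hL k F hM y ν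
    _ = d * M := by simp

end Sizes

end

end Summit.QuantumFields.BalabanUV.T4Continuum.SmoothRefineWhitney
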